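import Literature.NumberTheory.Automorphic.ResGLnConeDictionary
import Literature.NumberTheory.Automorphic.ResGLnCuspidalCohomologyApexBasic
import HarnessLib

/-!
# The centre acts on the coefficient module `E_λ(ℂ) ⊗ ε_S` by the total weight —
# crux HeckeEigenvalueField (stmt-Langlands-13632), line Sketch, stub `stub_sigmaS_central` (CENTRAL-E)

Statement.  Let `K` be a number field, `G_∞ = GL_n(K_∞)` the archimedean group of the datum
`𝒟 = AutomorphyDatum.gl n K hcpt` (`K_∞ = mixedSpace K`), `Z = 1 ∈ 𝔤 = M_n(K_∞)` the generator of the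
split centre, `λ = (λ_τ)_{τ : K → ℂ}` a family of DOMINANT weights and
`σS = E_λ(ℂ) ⊗ ε_S = (⨂_τ V_{λ_τ}(ℂ) ∘ GL_n(τ̃)) ⊗ ε_S` the sign-twisted archimedean coefficient
representation (`ConeDictionary.σS`, differential `ConeDictionary.σ𝔤S`).  Then along the one-parameter
group `exp(tZ) = e^t · 1` the representation acts by the scalar `e^{t w}` and `σ𝔤S(Z)` acts by `w`, where
`w = ∑_τ ∑_i λ_τ(i)` is the total weight.

Proof.  The Lie half is the tree's `ConeDictionary.archCoeffLie_centerOne` (`Z` acts by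
`coeffCentralWeight λ = ∑_τ (d_τ + n λ_{τ,n-1})`, `d_τ = ∑_i (λ_{τ,i} - λ_{τ,n-1})`), and for dominant
`λ_τ` one has `d_τ + n λ_{τ,n-1} = ∑_i λ_{τ,i}` (`coeffDegree_add_mul_lowestEntry`).  The group half is a
direct computation: `exp(t · 1) = e^t · 1` in `M_n(K_∞)` (`Matrix.exp_diagonal`), `τ̃(e^t · 1) = e^t · 1`
in `M_n(ℂ)`, the Weyl module `S_μ(ℂⁿ) ⊆ (ℂⁿ)^{⊗d}` is homogeneous of degree `d` under scalars and
`det(e^t · 1)^{λ_{n-1}} = e^{t n λ_{n-1}}`, so the factor `V_{λ_τ}` sees the scalar `e^{t(d_τ + n λ_{τ,n-1})}`,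
the tensor product over `τ` multiplies them, and the sign character is trivial on one-parameter
subgroups (`ResGLnCohomology.signChar_expMem`). [cite: FultonHarris1991, §15.5]
[cite: BorelWallach2000, 0 §2.3]

NOTE.  Without dominance the registered right-hand side `∑_τ ∑_i λ_τ(i)` is wrong: for `n = 2`,
`λ_τ = (0, 1)` the module `V_{λ_τ} = det` is one-dimensional and `Z` acts by `2`, not `1`; the
hypothesis `hdom` is therefore part of the statement.
-/

set_option linter.dupNamespace false -- project-wide: `Summit.Langlands.Langlands` is the mandated namespace

noncomputable section

open scoped Matrix TensorProduct Classical MatrixGroups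
open NumberField NumberField.mixedEmbedding
open Literature.NumberTheory.Automorphic Literature.NumberTheory.DiophantineGeometry

namespace Summit.Langlands.Langlands.Theorems.HeckeEigenvalueField.Res

open ResGLnCohomology RealMatrixGroup ParallelWeight

section Helpers

variable {n : ℕ} {K : Type} [Field K] [NumberField K]

/-- For a dominant weight `λ` of `GL_n`: `d + n λ_{n-1} = ∑_i λ_i`, where `d = ∑_i (λ_i - λ_{n-1})` is the
degree of the polynomial part (`GLnCohomology.coeffDegree`) and `λ_{n-1}` the lowest entry. [folklore] -/
theorem coeffDegree_add_mul_lowestEntry {m : ℕ} {wt : Fin m → ℤ} (hwt : Weight.IsDominant wt) :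
    ((GLnCohomology.coeffDegree wt : ℕ) : ℤ) + m * GLnCohomology.lowestEntry wt = ∑ i, wt i := by
  cases m with
  | zero => simp [GLnCohomology.coeffDegree, GLnCohomology.lowestEntry]
  | succ m =>
    rw [GLnCohomology.lowestEntry_succ, GLnCohomology.coeffDegree, Nat.cast_sum]
    have h : ∀ i : Fin (m + 1),
        ((GLnCohomology.polyShift wt i : ℕ) : ℤ) = wt i - wt (Fin.last m) := fun i => by
      rw [GLnCohomology.polyShift, GLnCohomology.lowestEntry_succ,
        Int.toNat_of_nonneg (sub_nonneg.2 ((show Antitone wt from hwt) (Fin.le_last i)))]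
    simp only [h, Finset.sum_sub_distrib, Finset.sum_const, Finset.card_univ, Fintype.card_fin]
    push_cast
    ring

/-- For a dominant family `λ`, the central weight `coeffCentralWeight λ = ∑_τ (d_τ + n λ_{τ,n-1})` of the
tree is the total weight `∑_τ ∑_i λ_τ(i)`. [folklore] -/
theorem coeffCentralWeight_eq_of_isDominant {lam : (K →+* ℂ) → Fin n → ℤ}
    (hdom : ∀ τ, Weight.IsDominant (lam τ)) :
    ConeDictionary.coeffCentralWeight n K lam = ∑ τ : K →+* ℂ, ∑ i : Fin n, ((lam τ i : ℝ) : ℂ) := by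
  rw [ConeDictionary.coeffCentralWeight]
  refine Finset.sum_congr rfl fun τ _ => ?_
  have h := congrArg (Int.cast : ℤ → ℂ) (coeffDegree_add_mul_lowestEntry (hdom τ))
  push_cast at h ⊢
  exact h

/-- `exp(t · 1) = e^t · 1` in `M_n(K_∞)`. [folklore] -/
theorem exp_smul_one_mixedSpace (t : ℝ) :
    NormedSpace.exp (t • (1 : Matrix (Fin n) (Fin n) (mixedSpace K))) =
      algebraMap ℝ (Matrix (Fin n) (Fin n) (mixedSpace K)) (Real.exp t) := by
  rw [← Algebra.algebraMap_eq_smul_one, Matrix.algebraMap_eq_diagonal, Matrix.algebraMap_eq_diagonal,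
    Matrix.exp_diagonal]
  congr 1
  funext i
  rw [Pi.coe_exp, Pi.algebraMap_apply, Pi.algebraMap_apply, Real.exp_eq_exp_ℝ]
  exact (NormedSpace.algebraMap_exp_comm t).symm

omit [NumberField K] in
/-- Through `τ̃ : K_∞ → ℂ`, a real scalar matrix `r · 1 ∈ GL_n(K_∞)` becomes `r · 1 ∈ GL_n(ℂ)`. [folklore] -/
theorem coe_map_embeddingExt_of_eq_algebraMap (τ : K →+* ℂ) {g : GL (Fin n) (mixedSpace K)} {r : ℝ}
    (hg : (g : Matrix (Fin n) (Fin n) (mixedSpace K)) = algebraMap ℝ (Matrix (Fin n) (Fin n) (mixedSpace K)) r) :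
    ((Matrix.GeneralLinearGroup.map (embeddingExt τ : mixedSpace K →+* ℂ) g : GL (Fin n) ℂ) :
        Matrix (Fin n) (Fin n) ℂ) = (r : ℂ) • (1 : Matrix (Fin n) (Fin n) ℂ) := by
  change (g : Matrix (Fin n) (Fin n) (mixedSpace K)).map (embeddingExt τ) = _
  rw [hg, ← AlgHom.mapMatrix_apply, AlgHom.commutes, Algebra.algebraMap_eq_smul_one]
  exact (Complex.coe_smul r _).symm

/-- A scalar matrix `c · 1 ∈ GL_n(ℂ)` acts on `(ℂⁿ)^{⊗d}` by `c^d`. [cite: FultonHarris1991, §6.1] -/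
theorem glTensorRep_of_coe_eq_smul_one {d : ℕ} {g : GL (Fin n) ℂ} {c : ℂ}
    (hg : (g : Matrix (Fin n) (Fin n) ℂ) = c • (1 : Matrix (Fin n) (Fin n) ℂ))
    (x : TensorPower ℂ d (Fin n → ℂ)) :
    glTensorRep (Fin n) ℂ d g x = c ^ d • x := by
  induction x using PiTensorProduct.induction_on with
  | smul_tprod r v =>
    rw [map_smul, glTensorRep_tprod, hg]
    have h := MultilinearMap.map_smul_univ (PiTensorProduct.tprod ℂ (s := fun _ : Fin d => Fin n → ℂ))
      (fun _ => c) v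
    simp only [Finset.prod_const, Finset.card_univ, Fintype.card_fin] at h
    simp only [Matrix.smul_mulVec, Matrix.one_mulVec]
    rw [h, smul_comm]
  | add x y hx hy => rw [map_add, hx, hy, smul_add]

/-- A scalar matrix `c · 1 ∈ GL_n(ℂ)` acts on `V_λ(ℂ) = S_μ(ℂⁿ) ⊗ det^{λ_{n-1}}` by
`(c^n)^{λ_{n-1}} c^d`. [cite: FultonHarris1991, §15.5] -/
theorem coeffRepGL_of_coe_eq_smul_one (wt : Fin n → ℤ) {g : GL (Fin n) ℂ} {c : ℂ}
    (hg : (g : Matrix (Fin n) (Fin n) ℂ) = c • (1 : Matrix (Fin n) (Fin n) ℂ))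
    (w : GLnCohomology.CoeffModule ℂ n wt) :
    GLnCohomology.coeffRepGL ℂ n wt g w =
      ((c ^ n) ^ GLnCohomology.lowestEntry wt * c ^ GLnCohomology.coeffDegree wt) • w := by
  rw [GLnCohomology.coeffRepGL_apply, Units.val_zpow_eq_zpow_val, Matrix.GeneralLinearGroup.val_det_apply,
    hg, Matrix.det_smul, Matrix.det_one, mul_one, Fintype.card_fin, mul_smul]
  congr 1
  apply Subtype.ext
  change ((weylRep ℂ (Fin n) (GLnCohomology.coeffPartition wt) g (GLnCohomology.CoeffModule.toWeyl ℂ w) :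
      ↥(weylModule ℂ (Fin n) (GLnCohomology.coeffPartition wt))) : TensorPower ℂ (GLnCohomology.coeffDegree wt) (Fin n → ℂ)) =
    c ^ GLnCohomology.coeffDegree wt • ((GLnCohomology.CoeffModule.toWeyl ℂ w :
      ↥(weylModule ℂ (Fin n) (GLnCohomology.coeffPartition wt))) : TensorPower ℂ (GLnCohomology.coeffDegree wt) (Fin n → ℂ))
  rw [coe_weylRep_apply, glTensorRep_of_coe_eq_smul_one hg]

/-- The factor `V_λ(ℂ) ∘ GL_n(τ̃)` of the coefficient module sees a real scalar matrix `r · 1 ∈ G_∞` as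
the scalar `(r^n)^{λ_{n-1}} r^d`. [cite: FultonHarris1991, §15.5] -/
theorem factorRep_of_coe_eq_algebraMap (wt : Fin n → ℤ) (τ : K →+* ℂ) {g : (archGroupGL n K).carrier}
    {r : ℝ} (hg : ((g : GL (Fin n) (mixedSpace K)) : Matrix (Fin n) (Fin n) (mixedSpace K)) =
      algebraMap ℝ (Matrix (Fin n) (Fin n) (mixedSpace K)) r)
    (w : GLnCohomology.CoeffModule ℂ n wt) :
    factorRep K n wt τ g w =
      (((r : ℂ) ^ n) ^ GLnCohomology.lowestEntry wt * (r : ℂ) ^ GLnCohomology.coeffDegree wt) • w := by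
  rw [factorRep_apply]
  exact coeffRepGL_of_coe_eq_smul_one wt (coe_map_embeddingExt_of_eq_algebraMap τ hg) w

/-- **`E_λ(ℂ) = ⨂_τ V_{λ_τ}(ℂ)` sees a real scalar matrix `r · 1 ∈ G_∞` as the scalar
`∏_τ (r^n)^{λ_{τ,n-1}} r^{d_τ}`** (the tensor product multiplies the factor scalars).
[cite: FultonHarris1991, §15.5] -/
theorem archCoeffRep_of_coe_eq_algebraMap (lam : (K →+* ℂ) → Fin n → ℤ) {g : (archGroupGL n K).carrier}
    {r : ℝ} (hg : ((g : GL (Fin n) (mixedSpace K)) : Matrix (Fin n) (Fin n) (mixedSpace K)) =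
      algebraMap ℝ (Matrix (Fin n) (Fin n) (mixedSpace K)) r)
    (v : CoeffModule ℂ n K lam) :
    archCoeffRep n K lam g v =
      (∏ τ : K →+* ℂ, (((r : ℂ) ^ n) ^ GLnCohomology.lowestEntry (lam τ) *
        (r : ℂ) ^ GLnCohomology.coeffDegree (lam τ))) • v := by
  set s : (K →+* ℂ) → ℂ := fun τ =>
    ((r : ℂ) ^ n) ^ GLnCohomology.lowestEntry (lam τ) * (r : ℂ) ^ GLnCohomology.coeffDegree (lam τ) with hs
  have key : archCoeffRep n K lam g = (∏ τ, s τ) • LinearMap.id := by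
    refine CoeffModule.hom_ext fun f => ?_
    rw [ResGLnCohomology.archCoeffRep_apply_tprod, LinearMap.smul_apply, LinearMap.id_apply]
    have hf : (fun τ => factorRep K n (lam τ) τ g (f τ)) = fun τ => s τ • f τ :=
      funext fun τ => factorRep_of_coe_eq_algebraMap (lam τ) τ hg (f τ)
    rw [hf]
    exact MultilinearMap.map_smul_univ (PiTensorProduct.tprod ℂ) s f
  exact LinearMap.congr_fun key v

/-- For a dominant family, the product of the factor scalars at `r = e^t` is `e^{t w}`,
`w = ∑_τ ∑_i λ_τ(i)`. [folklore] -/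
theorem prod_factorScalar_exp_eq {lam : (K →+* ℂ) → Fin n → ℤ} (hdom : ∀ τ, Weight.IsDominant (lam τ))
    (t : ℝ) :
    (∏ τ : K →+* ℂ, ((((Real.exp t : ℝ) : ℂ) ^ n) ^ GLnCohomology.lowestEntry (lam τ) *
        ((Real.exp t : ℝ) : ℂ) ^ GLnCohomology.coeffDegree (lam τ))) =
      ((Real.exp (t * ∑ τ : K →+* ℂ, ∑ i : Fin n, (lam τ i : ℝ)) : ℝ) : ℂ) := by
  rw [Complex.ofReal_exp, Complex.ofReal_exp]
  push_cast
  rw [Finset.mul_sum, Complex.exp_sum]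
  refine Finset.prod_congr rfl fun τ _ => ?_
  rw [← Complex.exp_nat_mul (t : ℂ) n, ← Complex.exp_int_mul, ← Complex.exp_nat_mul (t : ℂ),
    ← Complex.exp_add]
  congr 1
  have h := congrArg (Int.cast : ℤ → ℂ) (coeffDegree_add_mul_lowestEntry (hdom τ))
  push_cast at h
  rw [← h]
  ring

end Helpers

/-- **Stub CENTRAL-E — the centre acts on the coefficients by the total weight**: along the central
one-parameter group `exp(tZ) = e^t · 1` (`Z = 1 ∈ 𝔤`), the sign-twisted algebraic representation
`σS = (⊗_τ V_{λ_τ}) ⊗ ε_S` acts by the scalar `e^{t w}`, and its differential `σ𝔤S(Z)` by `w`, where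
`w = ∑_τ ∑_i λ_τ(i)` is the total degree, for a DOMINANT family `λ` (each `V_{λ_τ} = S_μ ⊗ det^{λ_{τ,n-1}}`
is homogeneous of degree `|μ| + n λ_{τ,n-1} = |λ_τ|` in `GL_n`, the sign character is trivial on
one-parameter subgroups). [cite: FultonHarris1991, §15.5] [cite: BorelWallach2000, 0 §2.3] -/
theorem stub_sigmaS_central {n : ℕ} {K : Type} [Field K] [NumberField K]
    (hcpt : isCompact_glFiniteIntegralLevel n K)
    (S : Finset {w : InfinitePlace K // w.IsReal}) (lam : (K →+* ℂ) → Fin n → ℤ)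
    (hdom : ∀ τ, Weight.IsDominant (lam τ)) :
    (∀ (t : ℝ) (v : ResGLnCohomology.CoeffModule ℂ n K lam),
      ConeDictionary.σS hcpt S lam ((AutomorphyDatum.gl n K hcpt).arch.expMem
          (t • (⟨1, trivial⟩ : (AutomorphyDatum.gl n K hcpt).arch.lie))) v =
        (Real.exp (t * ∑ τ : K →+* ℂ, ∑ i : Fin n, (lam τ i : ℝ)) : ℂ) • v) ∧
    ∀ v : ResGLnCohomology.CoeffModule ℂ n K lam,
      ConeDictionary.σ𝔤S hcpt lam (⟨1, trivial⟩ : (AutomorphyDatum.gl n K hcpt).arch.lie) v =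
        ((∑ τ : K →+* ℂ, ∑ i : Fin n, (lam τ i : ℝ)) : ℂ) • v := by
  refine ⟨fun t v => ?_, fun v => ?_⟩
  · -- the group half: `σS(exp tZ) = ε_S(exp tZ) • E_λ(e^t · 1) = 1 • ∏_τ e^{t |λ_τ|}`
    have hg : (((archGroupGL n K).expMem (t • (⟨1, trivial⟩ : (archGroupGL n K).lie)) :
        GL (Fin n) (mixedSpace K)) : Matrix (Fin n) (Fin n) (mixedSpace K)) =
        algebraMap ℝ (Matrix (Fin n) (Fin n) (mixedSpace K)) (Real.exp t) := by
      rw [coe_expMem, coe_expGL]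
      exact exp_smul_one_mixedSpace t
    change archCoeffRepSign n K S lam
      ((archGroupGL n K).expMem (t • (⟨1, trivial⟩ : (archGroupGL n K).lie))) v = _
    rw [archCoeffRepSign_apply, signChar_expMem, one_smul, archCoeffRep_of_coe_eq_algebraMap lam hg v,
      prod_factorScalar_exp_eq hdom t]
  · -- the Lie half: the tree's `archCoeffLie_centerOne`, and `coeffCentralWeight λ = ∑_τ ∑_i λ_τ(i)`
    have h := ConeDictionary.archCoeffLie_centerOne (hcpt := hcpt) lam v
    rw [coeffCentralWeight_eq_of_isDominant hdom] at h
    change ConeDictionary.σ𝔤S hcpt lam (ConeDictionary.centerOne n K hcpt) v = _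
    exact h

end Summit.Langlands.Langlands.Theorems.HeckeEigenvalueField.Res

end
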